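/-
COR-CM (cell pub-hodgecm2, stage 2 of the Hodge ladder) — count-neutral KERNEL COMBINATORICS «the sheared dihedral family», part IX: the bridge from the
sheared dihedral datum (odd level) to the slice datum (seat prover-pub-hodgecm2-b23-g52-0, binder prover b23, gen 52; claim «SYLOW TRANSFER XII + THE
SHEARED DIHEDRAL FAMILY», HOME/INBOX.md l.23708).  Theorems only, on parts I and VII (`Census/ShearedDihedralDatum.lean`,
`Census/ShearedDihedralSliceDictionary.lean`) and gen 44ʼs counting exhaustion (`QuarticInversion.exhaust_of_card`) BY NAME; no `decide` beyond `ZMod 2`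
literals, no certificate, no named fact, no `sorry`.  `Interfaces.lean` (C1), every E term, B01, `Transposition/*`, `PortJoin/*`, `D2Bridge/*` untouched.
HONEST FRAMING: `HC_CM` is NOT proved, here or anywhere in the tree; nothing here is a period, a count of record or a headline.
-/
import Summits.HodgeConjecture.CorCM.Census.ShearedDihedralSliceDictionary
import Summits.HodgeConjecture.CorCM.Census.ShearedDihedralDatum
import Summits.HodgeConjecture.CorCM.Census.QuarticInversionExhaust

/-!
# The sheared dihedral family, IX: for odd `n`, a sheared dihedral datum gives a slice datum over `ℤ/n` (square class `0`)

For a sheared dihedral datum `D` on `(G, c)` at ODD level `n` (`G ≅ X_n = ℤ/n ⋊ D₄` with Klein kernel, part I) the rotation subgroup splits,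
`⟨g⟩ = ⟨c⟩ × ⟨g²⟩ ≅ ℤ/2 × ℤ/n`, and
  `ι(ε, a) := c^ε (g²)^a`,  `y := x`,  `t := s`
is a SLICE DATUM of square class `0` (part VII): `ι` is additive and injective with `ι(1,0) = c`, `x` inverts it (`x g² x = g⁻²`) with `x² = 1`, `s`
centralises it with `s² = 1`, `x s = c s x`, and the four cosets exhaust `G` (gen 44ʼs `exhaust_of_card` from `|G| = 8n`).
**`nonempty_sliceDatum`**: so every theorem of the slice column (parts V–VIII and sequels: labels `Ty₄ (ℤ/n)`, motions `twH₄`, `twY 0`, `twS`, the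
dictionary `typeEquiv`) applies to `X_n`.  All [folklore].

## References
* [Pohlmann1968] H. Pohlmann, Algebraic cycles on abelian varieties of complex multiplication type, Ann. of Math. 88 (1968), Thm 1.
-/

namespace Summit.HodgeConjecture.CorCM.Census.ShearedDihedral

open Finset

noncomputable section

variable {G : Type*} [Group G] [Fintype G] [DecidableEq G] {c : G} {n : ℕ}
variable (D : Datum G c n)

namespace Datum

include D

omit [Fintype G] [DecidableEq G] in
/-- `g²` has order `n`. [folklore] -/
theorem orderOf_g_sq : orderOf (D.g ^ 2) = n := by
  rw [orderOf_pow' D.g two_ne_zero, D.hord, Nat.gcd_mul_right_left, Nat.mul_div_cancel_left _ two_pos]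

omit [Fintype G] [DecidableEq G] in
/-- For odd `n`, `g = c · (g²)^{(n+1)/2}`: the rotation subgroup is `⟨c⟩ × ⟨g²⟩`. [folklore] -/
theorem g_eq_c_mul_sq_pow (hn : Odd n) : D.g = c * (D.g ^ 2) ^ ((n + 1) / 2) := by
  obtain ⟨m, rfl⟩ := hn
  rw [show (2 * m + 1 + 1) / 2 = m + 1 by omega, ← pow_mul, show 2 * (m + 1) = (2 * m + 1) + 1 by ring, pow_succ, D.hgn, ← mul_assoc,
    D.c_mul_c, one_mul]

omit [DecidableEq G] in
/-- **For odd `n` the sheared dihedral datum gives a slice datum of square class `0` over `ℤ/n`** (`ι(ε,a) = c^ε (g²)^a`, `y = x`, `t = s`).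
[folklore] -/
theorem nonempty_sliceDatum (hn : Odd n) : Nonempty (SliceDatum G c (ZMod n) 0) := by
  haveI : NeZero n := ⟨fun h => by simp [h] at hn⟩
  have hn0 : n ≠ 0 := NeZero.ne n
  set z := D.g ^ 2 with hzdef
  have hzn : orderOf z = n := D.orderOf_g_sq
  have hordc : orderOf c = 2 := orderOf_eq_prime (by rw [pow_two, D.c_mul_c]) D.c_ne_one
  have hcz : Commute c z := (D.g_mul_c.pow_left 2).symm
  have hsz : Commute D.s z := (D.commute_g_s.pow_left 2).symm
  have hsc : Commute D.s c := D.s_mul_c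
  have hxc : Commute D.x c := D.x_mul_c
  -- the embedding `ι (ε, a) = c^ε z^a`
  set ι : ZMod 2 × ZMod n → G := fun ab => c ^ ab.1.val * z ^ ab.2.val with hι
  have hcpow : ∀ a b : ZMod 2, c ^ (a + b).val = c ^ a.val * c ^ b.val := fun a b => by
    rw [← pow_add, pow_inj_mod, hordc, ZMod.val_add, Nat.mod_mod]
  have hzpow : ∀ a b : ZMod n, z ^ (a + b).val = z ^ a.val * z ^ b.val := fun a b => by
    rw [← pow_add, pow_inj_mod, hzn, ZMod.val_add, Nat.mod_mod]
  have hadd : ∀ a b, ι (a + b) = ι a * ι b := fun a b => by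
    simp only [hι, Prod.fst_add, Prod.snd_add]
    rw [hcpow, hzpow, (hcz.pow_pow b.1.val a.2.val).mul_mul_mul_comm]
  have hι0 : ι 0 = 1 := by simp only [hι, Prod.fst_zero, Prod.snd_zero, ZMod.val_zero, pow_zero, mul_one]
  have hιneg : ∀ a, ι (-a) = (ι a)⁻¹ := fun a =>
    eq_inv_of_mul_eq_one_left (by rw [← hadd, neg_add_cancel, hι0])
  have hmap_c : ι (1, 0) = c := by
    simp only [hι, ZMod.val_zero, pow_zero, mul_one]
    rw [ZMod.val_one, pow_one]
  have hιmem : ∀ a, ι a ∈ Subgroup.zpowers D.g := fun a => by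
    have hc : c ∈ Subgroup.zpowers D.g := by
      have h : D.g ^ n ∈ Subgroup.zpowers D.g := Subgroup.pow_mem _ (Subgroup.mem_zpowers _) n
      rwa [D.hgn] at h
    exact mul_mem (Subgroup.pow_mem _ hc _) (Subgroup.pow_mem _ (Subgroup.pow_mem _ (Subgroup.mem_zpowers _) 2) _)
  have hinj : Function.Injective ι := by
    rintro ⟨a1, a2⟩ ⟨b1, b2⟩ h
    simp only [hι] at h
    have hg : (c ^ b1.val)⁻¹ * c ^ a1.val = z ^ b2.val * (z ^ a2.val)⁻¹ := by
      rw [inv_mul_eq_iff_eq_mul, ← mul_assoc, eq_mul_inv_iff_mul_eq]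
      exact h
    have hg1 : (c ^ b1.val)⁻¹ * c ^ a1.val = 1 := by
      have h2 : orderOf ((c ^ b1.val)⁻¹ * c ^ a1.val) ∣ 2 := by
        have hmem : (c ^ b1.val)⁻¹ * c ^ a1.val ∈ Subgroup.zpowers c :=
          mul_mem (inv_mem (Subgroup.pow_mem _ (Subgroup.mem_zpowers c) b1.val)) (Subgroup.pow_mem _ (Subgroup.mem_zpowers c) a1.val)
        have := (Subgroup.zpowers c).orderOf_dvd_natCard hmem
        rwa [Nat.card_zpowers, hordc] at this
      have hp' : orderOf ((c ^ b1.val)⁻¹ * c ^ a1.val) ∣ n := by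
        rw [hg]
        have hmem : z ^ b2.val * (z ^ a2.val)⁻¹ ∈ Subgroup.zpowers z :=
          mul_mem (Subgroup.pow_mem _ (Subgroup.mem_zpowers z) b2.val) (inv_mem (Subgroup.pow_mem _ (Subgroup.mem_zpowers z) a2.val))
        have := (Subgroup.zpowers z).orderOf_dvd_natCard hmem
        rwa [Nat.card_zpowers, hzn] at this
      have h1 : orderOf ((c ^ b1.val)⁻¹ * c ^ a1.val) ∣ 1 := by
        rw [← (Nat.coprime_two_left.mpr hn).gcd_eq_one]
        exact Nat.dvd_gcd h2 hp'
      exact orderOf_eq_one_iff.mp (Nat.dvd_one.mp h1)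
    have hc' : c ^ b1.val = c ^ a1.val := inv_mul_eq_one.mp hg1
    have hz' : z ^ b2.val = z ^ a2.val := by
      rw [hg1] at hg
      exact mul_inv_eq_one.mp hg.symm
    have e1 : b1.val = a1.val := by
      have := pow_inj_mod.mp hc'
      rwa [hordc, Nat.mod_eq_of_lt (ZMod.val_lt b1), Nat.mod_eq_of_lt (ZMod.val_lt a1)] at this
    have e2 : b2.val = a2.val := by
      have := pow_inj_mod.mp hz'
      rwa [hzn, Nat.mod_eq_of_lt (ZMod.val_lt b2), Nat.mod_eq_of_lt (ZMod.val_lt a2)] at this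
    exact Prod.ext (ZMod.val_injective _ e1.symm) (ZMod.val_injective _ e2.symm)
  -- `x` inverts `ι`
  have hxz : D.x * z * D.x⁻¹ = z⁻¹ := D.x_mul_pow_mul_xinv 2
  have hy_mul : ∀ a, D.x * ι a = ι (-a) * D.x := fun a => by
    rw [hιneg]
    simp only [hι]
    have h1 : D.x * z ^ a.2.val * D.x⁻¹ = (z ^ a.2.val)⁻¹ := by
      rw [← MulAut.conj_apply, map_pow, MulAut.conj_apply, hxz, inv_pow]
    have h2 : D.x * z ^ a.2.val = (z ^ a.2.val)⁻¹ * D.x := by rw [← h1, inv_mul_cancel_right]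
    -- `c^e` is its own inverse and commutes with `z`-powers
    have hcinv : (c ^ a.1.val)⁻¹ = c ^ a.1.val := by
      rw [← inv_pow, inv_eq_of_mul_eq_one_right D.c_mul_c]
    calc D.x * (c ^ a.1.val * z ^ a.2.val) = c ^ a.1.val * (D.x * z ^ a.2.val) := by
          rw [← mul_assoc, (hxc.pow_right a.1.val).eq, mul_assoc]
      _ = c ^ a.1.val * (z ^ a.2.val)⁻¹ * D.x := by rw [h2, mul_assoc]
      _ = (c ^ a.1.val)⁻¹ * (z ^ a.2.val)⁻¹ * D.x := by rw [hcinv]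
      _ = (c ^ a.1.val * z ^ a.2.val)⁻¹ * D.x := by rw [mul_inv_rev, ((hcz.pow_pow a.1.val a.2.val).inv_inv).eq]
  have hyy : D.x * D.x = ι ((0 : ZMod 2), 0) := by rw [D.hx2, show ((0 : ZMod 2), (0 : ZMod n)) = 0 from rfl, hι0]
  have ht_mul : ∀ a, D.s * ι a = ι a * D.s := fun a =>
    ((hsc.pow_right a.1.val).mul_right (hsz.pow_right a.2.val)).eq
  have hy_t : D.x * D.s = c * D.s * D.x := D.x_mul_s
  have hy_ne : ∀ a, D.x ≠ ι a := fun a h => D.x_notMem_zpowers_g (h ▸ hιmem a)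
  have ht_ne : ∀ a, D.s ≠ ι a := fun a h => D.hs (h ▸ hιmem a)
  have ht_ne' : ∀ a, D.s ≠ D.x * ι a := fun a h => D.s_mul_x_notMem_zpowers_g (by
    -- `s = x ι a` ⟹ `s x = x ι a x = x x ι(−a) = ι(−a)`
    have h1 : ι a * D.x = D.x * ι (-a) := by rw [hy_mul, neg_neg]
    have h2 : D.s * D.x = ι (-a) := by rw [h, mul_assoc, h1, ← mul_assoc, D.hx2, one_mul]
    rw [h2]; exact hιmem (-a))
  have hcardA : Fintype.card G = 8 * Fintype.card (ZMod n) := by rw [ZMod.card, D.card_eq_eight_mul]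
  have hexh := QuarticInversion.exhaust_of_card (ζ := (0 : ZMod 2)) ι D.x D.s hadd hinj hy_mul hyy hy_ne ht_ne ht_ne' hcardA
  exact ⟨{ ι := ι, y := D.x, t := D.s, map_add := hadd, map_c := hmap_c, y_mul := hy_mul, y_mul_y := hyy, t_mul := ht_mul,
           t_mul_t := D.hs2, y_mul_t := hy_t, inj := hinj, y_ne := hy_ne, t_ne := ht_ne, t_ne' := ht_ne', exhaust := hexh }⟩

end Datum

end

end Summit.HodgeConjecture.CorCM.Census.ShearedDihedral
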